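import Literature.Analysis.FluidPDE.TorusClassicalNSEnstrophyLifespan
import HarnessLib

/-!
# Enstrophy inequality and `V`-lifespan on `T³` (tools stub `stub_enstrophyLifespanTools`, block N-E,
# line `ergodic-budget-selection-closing`, crux `BaireTransfer.DenseLoudDesignerForces`, stmt-AnomalousDissipation-1143)

Summit-side wrapper at `d = Fin 3` of the Literature theorem
`Torus.IsClassicalNSSolutionOn.enstrophy_lifespan`
(`Literature/Analysis/FluidPDE/TorusClassicalNSEnstrophyLifespan.lean`): the a-priori half of
Robinson–Rodrigo–Sadowski 2016, Thm 6.8 (estimates (6.7), (6.9), (6.10), with a force) for classical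
solutions of NS_ν on `[a, b] × T³` — for `ν > 0` and levels `E₁` of the initial enstrophy `‖∇u(a)‖₂²` and `G`
of `‖∇f‖₂²` there are a lifespan `T = T(ν, E₁, G) > 0` and a dissipation budget `Y = Y(ν, E₁)` with
`‖∇u(t)‖₂² ≤ 2E₁ + 1` and `∫ₐᵗ ‖Δu‖₂² ≤ Y` for `t ∈ [a, b]`, `t ≤ a + T`.  The registered signature carries the
zero-mean hypothesis of the line's vocabulary; the Literature theorem does not need it.  Supports
stmt-AnomalousDissipation-1143 (tools stub of block N-E, the `V`-theory of classical solutions with constants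
depending on `V` / `L²_t H²` quantities only); nothing here closes an item.

References: Robinson–Rodrigo–Sadowski, *The Three-Dimensional Navier–Stokes Equations* (CUP 2016) Thm 6.8;
Constantin–Foias, *Navier–Stokes Equations* (1988) Ch. 10, (10.16).
-/

-- `Summit.<Summit>.<Problem>` is the tree's mandated summit-side namespace (CONVENTIONS §2); for this
-- single-conjunct summit the two coincide, so the duplicate is deliberate.
set_option linter.dupNamespace false

noncomputable section

open scoped BigOperators Topology ENNReal InnerProductSpace
open Filter Set Function MeasureTheory

namespace Summit.AnomalousDissipation.AnomalousDissipation.Theorems.DenseLoudDesignerForces.Ergodic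

open Literature.Analysis.FunctionSpaces Literature.Analysis.FunctionSpaces.Torus
open Literature.Analysis.FluidPDE Literature.Analysis.FluidPDE.Torus

/-- **Tools stub E2a — enstrophy inequality and a `V`-lifespan** (registered tools stub
`stub_enstrophyLifespanTools` of block N-E, crux stmt-AnomalousDissipation-1143, line
`ergodic-budget-selection-closing`).  For `ν > 0` and bounds `E₁` on the initial enstrophy `‖∇u(a)‖₂²` and
`G` on `‖∇f‖₂²`, there are `T = T(ν, E₁, G) > 0` and `Y = Y(ν, E₁, G)` such that every classical solution with
zero-mean slices on `[a, b] × T³` keeps `‖∇u(t)‖₂² ≤ 2E₁ + 1` and `∫ₐᵗ ‖Δu‖₂² ≤ Y` for `t ≤ a + T` — the case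
`d = Fin 3` of `Torus.IsClassicalNSSolutionOn.enstrophy_lifespan` (enstrophy balance + flux bound
`IsClassicalNSSolutionOn.enstrophy_flux_le` + fencing on `[a, a + T]`; the zero-mean hypothesis is not used).
RRS 2016 Thm 6.8 (the a-priori half; 3-D, local in time). [cite: RobinsonRodrigoSadowskiCUP2016, Thm 6.8 (6.7)–(6.10)] -/
theorem stub_enstrophyLifespanTools {ν : ℝ} (hν : 0 < ν) (E₁ G : ℝ) :
    ∃ T : ℝ, 0 < T ∧ ∃ Y : ℝ, ∀ {a b : ℝ} {f u : ℝ → (UnitAddTorus (Fin 3)) → (EuclideanSpace ℝ (Fin 3))}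
      {p : ℝ → (UnitAddTorus (Fin 3)) → ℝ}, IsClassicalNSSolutionOn (Icc a b) ν f u p → a < b →
      (∀ t ∈ Icc a b, HasZeroMean (u t)) → gradNormSq (u a) ≤ E₁ → (∀ t ∈ Icc a b, gradNormSq (f t) ≤ G) →
      (∀ t ∈ Icc a b, t ≤ a + T → gradNormSq (u t) ≤ 2 * E₁ + 1) ∧
      (∀ t ∈ Icc a b, t ≤ a + T → ∫ s in a..t, (∫ x, ‖laplacian (u s) x‖ ^ 2) ≤ Y) := by
  obtain ⟨T, hT, Y, h⟩ :=
    IsClassicalNSSolutionOn.enstrophy_lifespan (d := Fin 3) (Fintype.card_fin 3) hν E₁ G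
  exact ⟨T, hT, Y, fun hsol hab _ hE hG => h hsol hab hE hG⟩

end Summit.AnomalousDissipation.AnomalousDissipation.Theorems.DenseLoudDesignerForces.Ergodic

end
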